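import Summits.Langlands.Langlands.Theorems.IrreducibilityBySelfDualityHeckeEigenvalueFieldStubHullRelOpen
import Summits.Langlands.Langlands.Theorems.IrreducibilityBySelfDualityHeckeEigenvalueFieldStubHullPosDef
import Summits.Langlands.Langlands.Theorems.IrreducibilityBySelfDualityHeckeEigenvalueFieldStubSandwichIn
import Summits.Langlands.Langlands.Theorems.IrreducibilityBySelfDualityHeckeEigenvalueFieldStubSandwichOut
import Summits.Langlands.Langlands.Theorems.IrreducibilityBySelfDualityHeckeEigenvalueFieldStubAssembly
import Literature.NumberTheory.Automorphic.SiegelReducedFamiliesHull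
import Literature.NumberTheory.Automorphic.CongruenceSubgroupCohomologyFiniteDimensional
import Literature.NumberTheory.Automorphic.ArithmeticGroupCohomologyFiniteness
import Literature.NumberTheory.Automorphic.AdelicStabilizerArithmetic
import Literature.NumberTheory.Automorphic.ArithmeticQuotientCohomologyFiniteProofs
import Literature.NumberTheory.Automorphic.GLnAdelicStructureProofs
import Literature.Algebra.Homology.GroupCohomologyFiniteIndexModuleFinite
import HarnessLib

/-!
# Borel–Serre finite-dimensionality: congruence subgroups of `GL_n` over number fields (theorem)
# and subgroups of finite index of `GL_n(ℤ)` (theorem)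

Crux `HeckeEigenvalueField` (stmt-Langlands-13632), line `Sketch`.  With every stub of the
B programme landed (Brown's criterion in Čech form, the cone model, the archimedean fundamental set
and Siegel property, relative openness / positivity of Siegel-reduced families, sandwich-in /
sandwich-out, the assembly `stub_borelSerre_assembly`, and the Hull Lemma
`SiegelFamily.convexHull_isReduced_subset` in Literature), the named fact
`BorelSerre1973_finiteDimensional_groupCohomology_congruenceSubgroup` is a THEOREM
(`borelSerre1973_finiteDimensional_groupCohomology_congruenceSubgroup_holds`).  This file also
derives its `GL_n(ℤ)` sibling `BorelSerre1973_finiteDimensional_groupCohomology` (subgroups of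
finite index of `GL_n(ℤ)`, field coefficients): the `K = ℚ`, `U = GL_n(𝒪̂)` case gives
`GL_n(ℚ) ∩ GL_n(𝒪̂) = im GL_n(𝓞_ℚ)` (`comap_glFiniteIntegralLevel_globalEmbedding`), transported to
`GL_n(𝓞_ℚ)` and along `𝓞_ℚ ≃ ℤ` to `GL_n(ℤ)`, and Shapiro's lemma descends to subgroups of finite
index (`moduleFinite_groupCohomology_subgroup_of_finiteIndex`).

## References

* A. Borel, J.-P. Serre, *Corners and arithmetic groups*, Comment. Math. Helv. 48 (1973), §11.1,
  Thm. 11.4.4 [BorelSerre1973].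
* K. S. Brown, *Cohomology of Groups*, GTM 87 (1982), III (6.2), VIII (5.1) [Brown1982CohomologyGroups].
-/

noncomputable section

set_option linter.dupNamespace false -- project-wide: `Summit.Langlands.Langlands` is the mandated namespace

open scoped Classical Pointwise ComplexOrder Matrix
open NumberField IsDedekindDomain CategoryTheory
open Literature.NumberTheory.Automorphic Literature.Algebra.Homology

namespace Summit.Langlands.Langlands.Theorems.HeckeEigenvalueField.Res

open BigHeckeGLn

/-- **Stub HULL-CONVEX of line `Sketch` — the Hull Lemma** (registered stub, closed): the convex
hull of the `(c, C, τ)`-reduced families of Hermitian matrices (`SiegelFamily.IsReduced`) lies in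
the `(c', C', τ')`-reduced families for constants depending only on `(m, c, C, τ)`.  This is the
Literature theorem `SiegelFamily.convexHull_isReduced_subset` (`SiegelReducedFamiliesHull`):
induction on `m` peeling the last index, the Schur complement of a convex combination exceeding
the combination of the Schur complements by a positive semidefinite slack of controlled size.
[folklore] -/
theorem stub_hull_convex :
    ∀ (ι : Type) (m : ℕ) (c C τ : ℝ), ∃ c' C' τ' : ℝ,
      convexHull ℝ {H : ι → Matrix (Fin m) (Fin m) ℂ | SiegelFamily.IsReduced c C τ m H} ⊆
        {H | SiegelFamily.IsReduced c' C' τ' m H} :=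
  fun ι m c C τ => SiegelFamily.convexHull_isReduced_subset (ι := ι) m c C τ

/-- **Borel–Serre for congruence subgroups of `GL_n` over a number field (THEOREM).**  For a field
`k`, a number field `K`, a compact open `U ≤ GL_n(𝔸_K^∞)` and a finite-dimensional representation
`A` of `Γ_U = GL_n(K) ∩ U` over `k`, every `H^q(Γ_U, A)` is finite-dimensional: the named fact
`BorelSerre1973_finiteDimensional_groupCohomology_congruenceSubgroup` discharged by the landed
assembly `stub_borelSerre_assembly` fed with the Hull Lemma and the four landed analytic stubs.
[cite: BorelSerre1973, §11.1, Thm. 11.4.4] -/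
theorem borelSerre1973_finiteDimensional_groupCohomology_congruenceSubgroup_holds :
    BorelSerre1973_finiteDimensional_groupCohomology_congruenceSubgroup :=
  fun k _ n K _ _ U hUo hUc A hA q =>
    stub_borelSerre_assembly stub_hull_convex
      (fun ι _ m c C τ => stub_hull_relOpen ι m c C τ) stub_hull_posDef
      (fun n K _ _ Ω h₁ h₂ h₃ t ht => stub_sandwich_in n K Ω h₁ h₂ h₃ t ht)
      (fun n K _ _ c C τ => stub_sandwich_out n K c C τ) k n K U hUo hUc A hA q

/-- **`GL_n(𝓞_K)` has finite-dimensional cohomology on finite-dimensional coefficients** (every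
number field `K`, every field `k`): the congruence subgroup of `U = GL_n(𝒪̂_K)` is the image of
`GL_n(𝓞_K)` in `GL_n(K)` (`comap_glFiniteIntegralLevel_globalEmbedding`), isomorphic to `GL_n(𝓞_K)`
(`map_algebraMap_ringOfIntegers_injective`). [cite: BorelSerre1973, §11.1, Thm. 11.4.4] -/
theorem moduleFinite_groupCohomology_gl_ringOfIntegers (k : Type) [Field k] (n : ℕ) (K : Type)
    [Field K] [NumberField K] (B : Rep k (GL (Fin n) (𝓞 K))) [Module.Finite k B] (q : ℕ) :
    Module.Finite k (groupCohomology B q) := by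
  have h₀ : ∀ (A : Rep k ((glFiniteIntegralLevel n K).comap (globalEmbedding n K))),
      Module.Finite k A → ∀ m, Module.Finite k (groupCohomology A m) :=
    fun A hA m => borelSerre1973_finiteDimensional_groupCohomology_congruenceSubgroup_holds k n K
      (glFiniteIntegralLevel n K) (isOpen_glFiniteIntegralLevel n K)
      (isCompact_glFiniteIntegralLevel_holds n K) A hA m
  rw [comap_glFiniteIntegralLevel_globalEmbedding] at h₀
  exact moduleFinite_groupCohomology_of_mulEquiv
    (MonoidHom.ofInjective (map_algebraMap_ringOfIntegers_injective n K)).symm h₀ B q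

/-- **Borel–Serre for subgroups of finite index of `GL_n(ℤ)` (THEOREM)** — the named fact
`BorelSerre1973_finiteDimensional_groupCohomology`: for a field `k`, `Γ ≤ GL_n(ℤ)` of finite
index and a finite-dimensional `k`-linear representation `A` of `Γ`, every `H^q(Γ, A)` is
finite-dimensional.  From the congruence theorem at `K = ℚ`, `U = GL_n(𝒪̂)`, transport along
`GL_n(𝓞_ℚ) ≃* GL_n(ℤ)` (`Units.mapEquiv` of `Rat.ringOfIntegersEquiv.mapMatrix`), and Shapiro descent to `Γ`
(`moduleFinite_groupCohomology_subgroup_of_finiteIndex`).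
[cite: BorelSerre1973, §11.1, Thm. 11.4.4] [cite: Brown1982CohomologyGroups, III (6.2); VIII (5.1)] -/
theorem borelSerre1973_finiteDimensional_groupCohomology_holds :
    BorelSerre1973_finiteDimensional_groupCohomology := by
  intro k _ n Γ hΓ A hA q
  haveI := hΓ
  haveI : Module.Finite k A := hA
  have hZ : ∀ (B : Rep k (GL (Fin n) ℤ)), Module.Finite k B → ∀ m,
      Module.Finite k (groupCohomology B m) := fun B hB m => by
    haveI := hB
    exact moduleFinite_groupCohomology_of_mulEquiv
      (Units.mapEquiv (Rat.ringOfIntegersEquiv.mapMatrix (m := Fin n)).toMulEquiv :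
        GL (Fin n) (𝓞 ℚ) ≃* GL (Fin n) ℤ)
      (fun C hC m' => by
        haveI := hC
        exact moduleFinite_groupCohomology_gl_ringOfIntegers k n ℚ C m') B m
  exact moduleFinite_groupCohomology_subgroup_of_finiteIndex Γ hZ A q

end Summit.Langlands.Langlands.Theorems.HeckeEigenvalueField.Res

end
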